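import Literature.MathematicalPhysics.KineticTheory.FluctuationSpace
import HarnessLib

/-!
# Summable clustering extends from generators to their linear span

Topic `Literature/MathematicalPhysics/KineticTheory` (companion of `FluctuationSpace` and
`FluctuationFoelnerPositivity`). The clustering field `integrable_cov` of the hypothesis structure
`FluctuationStructure` asks, for ALL pairs `a, b` of local observables, that the truncated
correlation `x ↦ Cov_μ(a, b ∘ T_x)` be integrable on the group (for the lattice `ℤ` with counting
measure: absolutely summable). When the local observables are the linear span of a set `S` of
generators (for the infinite chain: the translates and time-evolutes of `j₀` and `h₀`), bilinearity of
the covariance on `L²(μ)` reduces this to the pairs of GENERATORS (`integrable_count_cov_of_span`).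
Everything is proved; tagged `[folklore]`. No definitions, no named facts.
-/

noncomputable section

open MeasureTheory ProbabilityTheory Filter Set Function

namespace Literature.MathematicalPhysics.KineticTheory

variable {Ω : Type*} [MeasurableSpace Ω] {μ : Measure Ω}

/-- **Summable clustering extends from generators to their span.** On a probability space with a
measure-preserving shift action of `ℤ`, let `S` be a set of observables whose span consists of
square-integrable functions. If `x ↦ Cov_μ(a, b ∘ T_x)` is integrable for the counting measure for all
generators `a, b ∈ S`, then the same holds for all `a, b` in the span (covariance is bilinear on `L²`).
[folklore] -/
theorem integrable_count_cov_of_span [IsProbabilityMeasure μ] (T : ShiftAction ℤ Ω)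
    (hT : ∀ x, MeasurePreserving (T x) μ μ) {S : Set (Ω → ℝ)}
    (hmem : ∀ a ∈ Submodule.span ℝ S, MemLp a 2 μ)
    (hgen : ∀ a ∈ S, ∀ b ∈ S, Integrable (fun x : ℤ => cov[a, b ∘ T x; μ]) (Measure.count : Measure ℤ)) :
    ∀ a ∈ Submodule.span ℝ S, ∀ b ∈ Submodule.span ℝ S,
      Integrable (fun x : ℤ => cov[a, b ∘ T x; μ]) (Measure.count : Measure ℤ) := by
  have hmemT : ∀ b ∈ Submodule.span ℝ S, ∀ x : ℤ, MemLp (b ∘ T x) 2 μ := fun b hb x =>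
    (hmem b hb).comp_measurePreserving (hT x)
  -- first: generators against the span
  have h1 : ∀ a ∈ S, ∀ b ∈ Submodule.span ℝ S,
      Integrable (fun x : ℤ => cov[a, b ∘ T x; μ]) (Measure.count : Measure ℤ) := by
    intro a ha b hb
    have haM : MemLp a 2 μ := hmem a (Submodule.subset_span ha)
    induction hb using Submodule.span_induction with
    | mem b hb => exact hgen a ha b hb
    | zero =>
        have e : (fun x : ℤ => cov[a, (0 : Ω → ℝ) ∘ T x; μ]) = fun _ => 0 := by
          funext x
          exact covariance_const_right (0 : ℝ)
        rw [e]; exact integrable_zero _ _ _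
    | add b b' hb hb' ih ih' =>
        have e : (fun x : ℤ => cov[a, (b + b') ∘ T x; μ]) =
            fun x => cov[a, b ∘ T x; μ] + cov[a, b' ∘ T x; μ] := by
          funext x
          exact covariance_add_right haM (hmemT b hb x) (hmemT b' hb' x)
        rw [e]; exact ih.add ih'
    | smul c b hb ih =>
        have e : (fun x : ℤ => cov[a, (c • b) ∘ T x; μ]) = fun x => c * cov[a, b ∘ T x; μ] := by
          funext x
          exact covariance_smul_right c
        rw [e]; exact ih.const_mul c
  -- then: the span against the span
  intro a ha b hb
  induction ha using Submodule.span_induction with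
  | mem a ha => exact h1 a ha b hb
  | zero =>
      have e : (fun x : ℤ => cov[(0 : Ω → ℝ), b ∘ T x; μ]) = fun _ => 0 := by
        funext x
        exact covariance_const_left (0 : ℝ)
      rw [e]; exact integrable_zero _ _ _
  | add a a' ha ha' ih ih' =>
      have e : (fun x : ℤ => cov[a + a', b ∘ T x; μ]) =
          fun x => cov[a, b ∘ T x; μ] + cov[a', b ∘ T x; μ] := by
        funext x
        exact covariance_add_left (hmem a ha) (hmem a' ha') (hmemT b hb x)
      rw [e]; exact ih.add ih'
  | smul c a ha ih =>
      have e : (fun x : ℤ => cov[c • a, b ∘ T x; μ]) = fun x => c * cov[a, b ∘ T x; μ] := by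
        funext x
        exact covariance_smul_left c
      rw [e]; exact ih.const_mul c

end Literature.MathematicalPhysics.KineticTheory

end
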